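import Literature.MathematicalPhysics.QuantumFieldTheory.Balaban1983to89.T4CouplingMatching
import Literature.MathematicalPhysics.QuantumFieldTheory.Balaban1983to89.Beta.AveragedAFCarrier

/-!
# `Balaban1983to89.Beta.CouplingMatchingCarrier` — the [III]-side consumer census EXTENDED TO ROAD (2): what the β
sub-cell's slope-carrying END grade `BetaAvgAFH s D γ β` buys for node U2 (COUPLING MATCHING) of the T⁴ uniqueness spine,
and what NO β-side grade of road (1) buys there (cell `pub-balaban`, unit `b2b-balaban-strat-b14` = β sub-cell CO-LEAD,
[III] side, gen 12; journal node III-T4-U2-CARRIER; companion of `Beta.AveragedAFCarrier` and of pv16's `T4CouplingMatching`)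

HONEST FRAMING (cell rule, page 1 of everything).  Road (1): discharging `BetaPertH` makes Bałaban's UV stability
UNCONDITIONAL — a real constructive-QFT result; NOT the continuum limit, NOT the Clay problem; «unconditional» in the sense
of Gloss 3″ (BETA-SPEC v1.9r §7.20 (c), v1.9t §7.21 (a)): the interval hypothesis of [Balaban1987RG1] Thm 2 p. 259 REPLACED
by the (R10-1′) partial-sums carrier, END statements under explicit γ-smallness, hypothetical on the wall's binders; never
«Theorem 2 as printed», never continuum / mass gap / Clay.  Road (2) (T4-DAG PAGE 1): existence AND uniqueness of the ε → 0
limit of gauge-invariant observables on a FIXED finite torus — strictly beyond UV stability; NOT infinite volume, NOT the mass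
gap, NOT Clay.  THIS MODULE DISCHARGES NOTHING: every theorem is bookkeeping over real sequences and over the cell's
hypothesis carriers (`FlowStep.HBeta`, `FlowStep.RGEqH`, `B12.Construction`, `AveragedAFCarrier.BetaAvgAFH`,
`B12Beta.OneLoopSplit`, `Drift.OneLoopDrift`, pv16's `T4CouplingMatching.ScaleShiftRate` / `HistLipschitz` / `FadingMemory` /
`LastOnlyLipschitz` / `disc`, `T4CauchySum.InjectedRate`); nothing about Bałaban's β-functions (1.22), their one-loop parts or
their scale dependence is asserted.  ABSOLUTE RULE (cell rule, verbatim): "No internally-minted statement may enter as a cited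
fact. Every hypothesis is either kernel-proved in this package or a verbatim quotation of a PUBLISHED theorem with page
reference. The manuscript(s) under audit are NOT citable for their own disputed steps — they are the thing under adjudication;
programme-internal (2001/route/tribunal) claims are never citable."  Accordingly every β-input below is a HYPOTHESIS BINDER; the
`[cite: …]` tags point at the printed display a theorem's objects come from, never at a proof.

CITATION HEADER (lean-in-tree rule).  T. Bałaban, *Renormalization group approach to lattice gauge field theories. I*, Commun.
Math. Phys. **109**, 249–301 (1987) [Balaban1987RG1] = [I] (cell paper B12; journal page = PDF page + 248) — (0.20) p. 256
*"1/g_k² = 1/g²_{k+1} + β_{k+1}(g_k)"* (tree `FlowStep.RGEqH`); Theorem 2 p. 259 first sentence (tree `DagBinding.EndpointExistence`;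
*"A proof of this theorem, based on perturbative calculations, will be given in a separate paper"* — UNPRINTED); p. 264 *"It is a
smooth function defined on the interval [0, γ], (or analytic), uniformly bounded on this interval together with all derivatives.
We will investigate other properties in a separate paper."*; p. 298 *"We write β_j as explicitly dependent on g_{j−1}, although it
depends also on all preceding coupling constants."* (tree `FlowStep.HBeta`).  These loci are those ALREADY typed in the two
imported modules (quoted there from the renders `HOME/b2b-balaban-ref1/pages/1987-cmp109-rg-I-small-field-p008/p011/p016/p050-x2.png`);
NOTHING is newly quoted here.  T. Bałaban, *Convergent renormalization expansions …*, CMP **119** (1988) [Balaban1988Convergent]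
= [III] enters only through `Beta.AveragedAFCarrier`'s consumers ((2.6)–(2.9), (2.46)).  WHAT IS REPRODUCED: nothing of either
paper; the module records, at statement level, one more CONSUMER of the sub-cell's carrier and two sharpness witnesses.

THE LOCATED INTERFACE POINT (this lineage, gen 12).  pv16's node U2 (`T4CouplingMatching`, T4-DAG §2 U2 / H3 «AF-RATE PACK»)
matches the running couplings of two infrared-pinned runs of (0.20) (K and K + 1 steps).  Its β-side inputs are (i) NE4 — the
scale-shift rate `ScaleShiftRate c θ γ β` and fading history moduli (the T⁴ cell's OWN located unprinted estimates, G-t4-U2-1 / G-t4-U2-2,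
row T4-U2.R) — and (ii) an ASYMPTOTIC-FREEDOM input making the feedback weights `Σ_{i≤K} (g^A_i)² g^B_{i+1}` K-UNIFORMLY summable,
typed there at the POINTWISE (eventual) grade `EventualLowerH b γ k₀ β` (`sum_weights_le_of_eventualLower`; = the
`Beta.Assembly.LimitForm.tail_lower` shape — Gloss-2 type).  The β sub-cell's BINDING deliverable is of a different grade:
Gloss 3″'s (R10-1′) carrier / the wall (`ComposedRoad.…remainderConst`, `AveragedAFCarrier.wallEND_…`) produce the
slope-carrying END grade `BetaAvgAFH s D γ β` — window sums of the β's, no pointwise bound on any single `β_{k+1}`.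
THIS MODULE:
§1  serves input (ii) AT THE SUB-CELL'S GRADE: `inv_sq_lower_of_avgAFH` (defected running `1/g_K² + s(K−i) − D ≤ 1/g_i²`),
    `sum_weights_le_of_avgAFH` (`s > 0`, `Dγ² ≤ ½` ⟹ `Σ_{i≤K}(g^A_i)²g^B_{i+1} ≤ (√2γ)³ + 2√2γ/s`, K-UNIFORM: the defect halves the
    infrared anchor `1/γ²`, i.e. replaces `γ` by `√2γ` in pv16's profile), and node U2's spine output with the carrier in place of
    `EventualLowerH`: `injectedRate_of_runs_avgAFH` (fixed-point form, smallness `C((√2γ)³ + 2√2γ/s) ≤ (1−θ)/2`) and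
    `injectedRate_of_runs_lastOnly_avgAFH` (Grönwall form, no smallness beyond `Lγ³ ≤ ½`);
§2  by name from the sub-cell's roads: `injectedRate_of_runs_driftOneSided` (Gloss 3″'s literal (R10-1′) carrier: drift + one-sided
    constant remainder, `r < b` STRICTLY, defect smallness `2Aγ² ≤ ½`) — so EVERY producer of `BetaAvgAFH` in `AveragedAFCarrier`
    §2/§2′ (including the wall sockets) feeds node U2's input (ii) by composition;
§3  SHARPNESS (a): input (ii) is an `s > 0` consumer — at slope 0 (the END grade `BetaPartialSumsLowerH`, even WITH the sign and
    endpoint existence) the weight sum is NOT K-uniform: along the pinned constant runs of the honest margin construction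
    `FlowStepRuns.modelOf (betaM b γ)` it equals `(K+1)γ³` (`Margin.weightSum_modelOf`, `Margin.slope_zero_not_enough_T4`);
§4  SHARPNESS (b) — WHAT NO β-SIDE GRADE OF ROAD (1) TOUCHES: input (i).  The history-free oscillating family
    `AveragedAFCarrier.Osc.betaO s c` with `0 < c < s` is of «THEOREM 2 AS PRINTED» grade — continuous, `0 < s − c ≤ β ≤ s + c` on
    every box (hence (AF-0s), `EventualForm`, `BetaAvgAFH`, (0.31) along its runs, everything road (1) consumes at ANY of its glosses)
    — yet it violates `ScaleShiftRate c′ θ γ` for every `c′` and every `θ < 1` (`Osc.not_scaleShiftRate`: consecutive scales differ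
    by `2c` at fixed couplings), EVERY infrared-pinned pair of its (0.20)-runs has coupling discrepancy EXACTLY `2c` one scale below
    the pin (`Osc.disc_last`), so NO injected geometric rate exists (`Osc.not_injectedRate`) and the effective coupling one scale
    above the unit scale does NOT converge as the cutoff is removed (`Osc.one_below_pin`: it alternates with the parity of K);
    all of it INHABITED for the honest construction `modelOf (betaO s c)`, which has endpoint existence (`Osc.thm2grade_no_matching`).
§5  (v1.1) THE (0.31)-LITERAL CONSUMERS OF ROAD (2) (the T⁴ cell's `h031 : Step.Discrete031 …` hypotheses): the carrier gives the
    running in DEFECTED form only (`discrete031Defect_of_avgAFH`, `discrete031_lower_farIR_of_avgAFH`); Gloss 3″'s literal oscillating carrier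
    violates the literal (0.31) on EVERY EVEN lattice and satisfies it on every odd one (`Osc.not_discrete031_even`, `Osc.discrete031_odd`;
    inhabited `Osc.modelOf_not_discrete031`) — no fine-lattice rescue, unlike Gloss 2 (`FlowStepRuns.thm2_fineLattices_of_eventualLower`); row C18.
§6  (v1.2) `Osc.not_injectedRate_poly`: the NE4 witness defeats `InjectedRate Cr p θ` for EVERY polynomial exponent `p` (the spine's general
    shape, node U6's logarithmic-running form) — C17 does not hinge on the exponent-0 form.
CONSEQUENCE FOR THE CENSUS (MISSING-B14 §8, new rows C16/C17; BETA-SPEC §5.16): C16 = node U2's AF weight sum — served at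
«slope > 0» by `BetaAvgAFH` exactly like C8/C13 ((2.46)), NOT at slope 0; C17 = node U2's NE4 — NOT a consumer of any grade the
β sub-cell's road (1) produces or even of «Theorem 2 as printed» + (0.31): it is scale-CONVERGENCE information on the β-family
((AF-0r)-type for `β⁰` + pv16's `RemainderShiftRate` for `β¹`, `T4CouplingMatching.scaleShiftRate_of_split`), an input of road (2)
IRREDUCIBLY beyond road (1) (the T⁴ cell types it as its hypothesis NE4; this module adds the β-family witness that without it the
coupling matching — and the K → ∞ convergence of the couplings — FAILS, not merely its proof).  NOT CLAIMED: anything about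
Bałaban's β; that NE4 holds or fails for it; anything of (M2⁺).

v1.1 (same unit and generation; APPEND-ONLY over v1 p182260 — every v1 declaration byte-unchanged, no new import): §5, census row C18.
v1.2 (same unit and generation; APPEND-ONLY over v1.1 p182374, no new import): §6 `Osc.not_injectedRate_poly`.

Imports pv16's `T4CouplingMatching` (→ `FlowStep`, `BetaDerivClause`, `T4CauchySum`) and `Beta.AveragedAFCarrier` (→ the β
sub-cell's consumer chain); restates nothing of them (everything USED BY NAME).  Mathlib only otherwise; 0 `sorry`, no `axiom`,
no `def` (theorems only).  Cell prose: `HOME/MISSING-B14.md` v12 §8 C16/C17 + §9.14, `HOME/BETA-SPEC.md` §5.16, GAPS C-sb14-25.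
-/

namespace Literature.MathematicalPhysics.QuantumFieldTheory.Balaban1983to89.Beta.CouplingMatchingCarrier

open Literature.MathematicalPhysics.QuantumFieldTheory.Balaban1983to89
open Literature.MathematicalPhysics.QuantumFieldTheory.Balaban1983to89.FlowStep
open Literature.MathematicalPhysics.QuantumFieldTheory.Balaban1983to89.DagBinding
open Literature.MathematicalPhysics.QuantumFieldTheory.Balaban1983to89.FlowStepRuns
open Literature.MathematicalPhysics.QuantumFieldTheory.Balaban1983to89.T4CouplingMatching
open Literature.MathematicalPhysics.QuantumFieldTheory.Balaban1983to89.Beta.AveragedAFCarrier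
open Literature.MathematicalPhysics.QuantumFieldTheory.Balaban1983to89.Beta.Drift (OneLoopDrift)
open Finset

noncomputable section

/-! ## 1. Node U2's asymptotic-freedom input (the K-uniform weight sum) FROM THE SLOPE-CARRYING END GRADE -/

/-- **The DEFECTED running along one run from the carrier**: `RGEqH K β g` with couplings in `]0,γ]` up to `K` and
`BetaAvgAFH s D γ β` give `1/g_K² + s(K − i) − D ≤ 1/g_i²` for `i ≤ K` (`FlowStep.inv_sq_telescopeH` + `BetaAvgAFH.onHorizon`) —
the lower half of (0.31) up to the additive defect `D`, from window sums only. [cite: Balaban1987RG1, (0.20) p.256 and (0.31) p.259] -/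
theorem inv_sq_lower_of_avgAFH {β : HBeta} {γ s D : ℝ} {K : ℕ} {g : ℕ → ℝ} (h : RGEqH K β g)
    (hbox : ∀ i, i ≤ K → 0 < g i ∧ g i ≤ γ) (hav : BetaAvgAFH s D γ β) {i : ℕ} (hi : i ≤ K) :
    1 / (g K) ^ 2 + s * ((K - i : ℕ) : ℝ) - D ≤ 1 / (g i) ^ 2 := by
  rw [inv_sq_telescopeH h hi le_rfl, Nat.cast_sub hi]
  have := hav.onHorizon g K hbox i K hi le_rfl
  linarith

/-- **THE AF WEIGHT SUM IS K-UNIFORM FROM THE CARRIER** (node U2's input (ii) at the β sub-cell's END grade with slope).  Along two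
runs of (0.20) (A: `K` steps, B: `K + 1` steps, couplings in `]0,γ]`) with `BetaAvgAFH s D γ β`, `s > 0`, and the defect small in the
sense `Dγ² ≤ ½`: `Σ_{i≤K} (g^A_i)² g^B_{i+1} ≤ (√2γ)³ + 2√2γ/s`.  Proof: `inv_sq_lower_of_avgAFH` for each run and `1/γ² − D ≥ 1/(2γ²)`
give `(g^A_i)² ≤ 1/a_{K−i}`, `g^B_{i+1} ≤ 1/√a_{K−i}` with pv16's profile `a_m = 1/(√2γ)² + s·m` (`T4CouplingMatching.prof (√2γ) s`);
then pv16's reflected telescoping `sum_profWeights_le`.  No pointwise bound on any `β_{k+1}`, no small-k sign. [cite: Balaban1987RG1, (0.31) p.259] -/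
theorem sum_weights_le_of_avgAFH {β : HBeta} {γ s D : ℝ} {K : ℕ} {gA gB : ℕ → ℝ}
    (hγ : 0 < γ) (hs : 0 < s) (hD : D * γ ^ 2 ≤ 1 / 2)
    (hA : RGEqH K β gA) (hB : RGEqH (K + 1) β gB)
    (hAbox : ∀ i, i ≤ K → 0 < gA i ∧ gA i ≤ γ) (hBbox : ∀ i, i ≤ K + 1 → 0 < gB i ∧ gB i ≤ γ)
    (hav : BetaAvgAFH s D γ β) :
    ∑ i ∈ range (K + 1), (gA i) ^ 2 * gB (i + 1) ≤ (Real.sqrt 2 * γ) ^ 3 + 2 * (Real.sqrt 2 * γ) / s := by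
  set γ' : ℝ := Real.sqrt 2 * γ with hγ'
  have h2 : Real.sqrt 2 ^ 2 = 2 := Real.sq_sqrt (by norm_num)
  have hγ'pos : 0 < γ' := mul_pos (Real.sqrt_pos.mpr (by norm_num)) hγ
  have hp0 := sprof_pos hγ'pos hs.le
  have hprof : ∀ m : ℕ, prof γ' s m = 1 / (2 * γ ^ 2) + s * m := by
    intro m; simp only [prof, hγ', mul_pow, h2]
  have hγ2 : 0 < γ ^ 2 := pow_pos hγ 2
  have hDle : D ≤ 1 / (2 * γ ^ 2) := by
    rw [le_div_iff₀ (by positivity)]; linarith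
  have hhalf : (1 : ℝ) / γ ^ 2 = 2 * (1 / (2 * γ ^ 2)) := by field_simp
  -- pointwise: u_i ≤ f (K - i), f m = (1/p_m²)(1/p_m), p_m = √(1/(2γ²) + s m)
  have hpt : ∀ i, i ≤ K →
      (gA i) ^ 2 * gB (i + 1) ≤ 1 / (sprof γ' s (K - i)) ^ 2 * (1 / sprof γ' s (K - i)) := by
    intro i hi
    have hgA := hAbox i hi
    have hgB := hBbox (i + 1) (by omega)
    have hgAK := hAbox K le_rfl
    have hgBK := hBbox (K + 1) le_rfl
    have hAK : 1 / γ ^ 2 ≤ 1 / (gA K) ^ 2 :=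
      one_div_le_one_div_of_le (pow_pos hgAK.1 2) (pow_le_pow_left₀ hgAK.1.le hgAK.2 2)
    have hBK : 1 / γ ^ 2 ≤ 1 / (gB (K + 1)) ^ 2 :=
      one_div_le_one_div_of_le (pow_pos hgBK.1 2) (pow_le_pow_left₀ hgBK.1.le hgBK.2 2)
    have h1 := inv_sq_lower_of_avgAFH hA hAbox hav hi
    have h2' := inv_sq_lower_of_avgAFH hB hBbox hav (i := i + 1) (by omega)
    have hKi : ((K + 1 - (i + 1) : ℕ) : ℝ) = ((K - i : ℕ) : ℝ) := by congr 1; omega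
    rw [hKi] at h2'
    have haA : prof γ' s (K - i) ≤ 1 / (gA i) ^ 2 := by rw [hprof]; linarith
    have haB : prof γ' s (K - i) ≤ 1 / (gB (i + 1)) ^ 2 := by rw [hprof]; linarith
    have hsqA : (gA i) ^ 2 ≤ 1 / (sprof γ' s (K - i)) ^ 2 := by
      rw [sprof_sq hγ'pos hs.le, le_one_div (pow_pos hgA.1 2) (prof_pos hγ'pos hs.le _)]
      exact haA
    have hsqB : (gB (i + 1)) ^ 2 ≤ (1 / sprof γ' s (K - i)) ^ 2 := by
      rw [one_div_pow, sprof_sq hγ'pos hs.le, le_one_div (pow_pos hgB.1 2) (prof_pos hγ'pos hs.le _)]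
      exact haB
    have hB' : gB (i + 1) ≤ 1 / sprof γ' s (K - i) :=
      (pow_le_pow_iff_left₀ hgB.1.le (one_div_pos.mpr (hp0 _)).le two_ne_zero).mp hsqB
    exact mul_le_mul hsqA hB' hgB.1.le (by positivity)
  calc ∑ i ∈ range (K + 1), (gA i) ^ 2 * gB (i + 1)
      ≤ ∑ i ∈ range (K + 1), 1 / (sprof γ' s (K - i)) ^ 2 * (1 / sprof γ' s (K - i)) :=
        Finset.sum_le_sum fun i hi => hpt i (Nat.lt_succ_iff.mp (mem_range.mp hi))
    _ ≤ γ' ^ 3 + 2 * γ' / s := sum_profWeights_le hγ'pos hs K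

/-- **NODE U2 IN THE SPINE'S SHAPE, FED BY THE CARRIER** (pv16's `injectedRate_of_runs` with the pointwise lower bound REPLACED by
the β sub-cell's END grade with slope).  A family of runs `K ↦ g^{(K)}` of (0.20) with the same `β`, all couplings in `]0,γ]`, all
pinned at the same renormalized coupling; NE4 `ScaleShiftRate c θ γ β` and fading history moduli (the T⁴ cell's hypotheses, by
pv16's names); `BetaAvgAFH s D γ β` with `s > 0`, `Dγ² ≤ ½`; smallness `C((√2γ)³ + 2√2γ/s) ≤ (1−θ)/2`.  THEN
`T4CauchySum.InjectedRate (2c/(1−θ)) 0 θ (fun K j ↦ disc (g K) (g (K+1)) j)`.  Bookkeeping (`disc_le_of_fadingMemory` +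
`sum_weights_le_of_avgAFH`); every β-input UNPRINTED and uninstantiated. [cite: Balaban1987RG1, (0.20) p.256 and Thm 2 p.259] -/
theorem injectedRate_of_runs_avgAFH {β : HBeta} {γ s D c θ C : ℝ} {Λ : ℕ → ℕ → ℝ} (g : ℕ → ℕ → ℝ) (gIR : ℝ)
    (hγ : 0 < γ) (hs : 0 < s) (hD : D * γ ^ 2 ≤ 1 / 2) (hθ0 : 0 < θ) (hθ1 : θ < 1) (hc : 0 ≤ c) (hC : 0 ≤ C)
    (hrun : ∀ K, RGEqH K β (g K)) (hbox : ∀ K i, i ≤ K → 0 < g K i ∧ g K i ≤ γ)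
    (hpin : ∀ K, g K K = gIR)
    (hS : ScaleShiftRate c θ γ β) (hL : HistLipschitz Λ γ β) (hΛ : FadingMemory C θ Λ)
    (hav : BetaAvgAFH s D γ β)
    (hsmall : C * ((Real.sqrt 2 * γ) ^ 3 + 2 * (Real.sqrt 2 * γ) / s) ≤ (1 - θ) / 2) :
    T4CauchySum.InjectedRate (2 * c / (1 - θ)) 0 θ (fun K j => disc (g K) (g (K + 1)) j) := by
  intro K j hj
  refine ⟨disc_nonneg _ _ _, ?_⟩
  have h := disc_le_of_fadingMemory hθ0 hθ1 hc hC (hrun K) (hrun (K + 1)) (hbox K) (hbox (K + 1))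
    ((hpin K).trans (hpin (K + 1)).symm) hS hL hΛ
    (sum_weights_le_of_avgAFH hγ hs hD (hrun K) (hrun (K + 1)) (hbox K) (hbox (K + 1)) hav) hsmall j hj
  simpa using h

/-- **NODE U2, GRÖNWALL / LAST-ONLY FORM, FED BY THE CARRIER** (pv16's `injectedRate_of_runs_lastOnly` with `EventualLowerH`
replaced by `BetaAvgAFH s D γ β`, `s > 0`, `Dγ² ≤ ½`): no smallness beyond `Lγ³ ≤ ½`; rate constant
`exp(2L((√2γ)³ + 2√2γ/s))·c/(1−θ)`, exponent 0. [cite: Balaban1987RG1, (0.20) p.256, Thm 2 p.259, §1 p.264] -/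
theorem injectedRate_of_runs_lastOnly_avgAFH {β : HBeta} {γ s D c θ L : ℝ} (g : ℕ → ℕ → ℝ) (gIR : ℝ)
    (hγ : 0 < γ) (hs : 0 < s) (hD : D * γ ^ 2 ≤ 1 / 2) (hθ0 : 0 < θ) (hθ1 : θ < 1) (hc : 0 ≤ c) (hL0 : 0 ≤ L)
    (hLγ : L * γ ^ 3 ≤ 1 / 2)
    (hrun : ∀ K, RGEqH K β (g K)) (hbox : ∀ K i, i ≤ K → 0 < g K i ∧ g K i ≤ γ)
    (hpin : ∀ K, g K K = gIR)
    (hS : ScaleShiftRate c θ γ β) (hLip : LastOnlyLipschitz L γ β) (hav : BetaAvgAFH s D γ β) :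
    T4CauchySum.InjectedRate
      (Real.exp (2 * (L * ((Real.sqrt 2 * γ) ^ 3 + 2 * (Real.sqrt 2 * γ) / s))) * c / (1 - θ)) 0 θ
      (fun K j => disc (g K) (g (K + 1)) j) := by
  intro K j hj
  refine ⟨disc_nonneg _ _ _, ?_⟩
  have h := disc_le_of_lastOnly hθ0.le hθ1 hc hL0 hLγ (hrun K) (hrun (K + 1)) (hbox K) (hbox (K + 1))
    ((hpin K).trans (hpin (K + 1)).symm) hS hLip j hj
  have hU := sum_weights_le_of_avgAFH hγ hs hD (hrun K) (hrun (K + 1)) (hbox K) (hbox (K + 1)) hav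
  have hw0 : ∀ i, i ≤ K → 0 ≤ (g K i) ^ 2 * g (K + 1) (i + 1) := fun i hi =>
    mul_nonneg (sq_nonneg _) (hbox (K + 1) (i + 1) (by omega)).1.le
  have hpart : ∑ m ∈ Ico j K, L * ((g K m) ^ 2 * g (K + 1) (m + 1))
      ≤ L * ((Real.sqrt 2 * γ) ^ 3 + 2 * (Real.sqrt 2 * γ) / s) := by
    rw [← Finset.mul_sum]
    refine mul_le_mul_of_nonneg_left (le_trans ?_ hU) hL0
    refine Finset.sum_le_sum_of_subset_of_nonneg (fun m hm => ?_) fun i hi _ => ?_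
    · exact mem_range.mpr (by have := (Finset.mem_Ico.mp hm).2; omega)
    · exact hw0 i (Nat.lt_succ_iff.mp (mem_range.mp hi))
  have hexp : Real.exp (2 * ∑ m ∈ Ico j K, L * ((g K m) ^ 2 * g (K + 1) (m + 1)))
      ≤ Real.exp (2 * (L * ((Real.sqrt 2 * γ) ^ 3 + 2 * (Real.sqrt 2 * γ) / s))) :=
    Real.exp_le_exp.mpr (by linarith)
  have hgeom : 0 ≤ c / (1 - θ) * θ ^ j := by
    have : 0 < 1 - θ := by linarith
    positivity
  calc disc (g K) (g (K + 1)) j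
      ≤ Real.exp (2 * ∑ m ∈ Ico j K, L * ((g K m) ^ 2 * g (K + 1) (m + 1))) * (c / (1 - θ) * θ ^ j) := h
    _ ≤ Real.exp (2 * (L * ((Real.sqrt 2 * γ) ^ 3 + 2 * (Real.sqrt 2 * γ) / s))) * (c / (1 - θ) * θ ^ j) :=
        mul_le_mul_of_nonneg_right hexp hgeom
    _ = Real.exp (2 * (L * ((Real.sqrt 2 * γ) ^ 3 + 2 * (Real.sqrt 2 * γ) / s))) * c / (1 - θ)
          * (((K : ℝ) + 1) ^ (0 : ℕ)) * θ ^ j := by ring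

/-! ## 2. By name from the sub-cell's roads: Gloss 3″'s literal (R10-1′) carrier feeds node U2's AF input -/

/-- **GLOSS 3″'s CARRIER ⟹ NODE U2's AF INPUT.**  A split `β = β⁰ + β¹` ([Balaban1987RG1] (2.12)–(2.14)) whose one-loop part
DRIFTS, `OneLoopDrift b A β⁰` (BINDER), whose remainder obeys `−r ≤ β¹_{k+1}` on the `]0,γ]`-histories (BINDER) with `r < b`
STRICTLY, gives `BetaAvgAFH (b − r) (2A) γ β` (`AveragedAFCarrier.betaAvgAFH_of_driftOneSided`), hence node U2's output under
NE4 + fading memory + the defect smallness `2Aγ² ≤ ½` + `C((√2γ)³ + 2√2γ/(b − r)) ≤ (1−θ)/2`.  So the wall's grade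
(`AveragedAFCarrier` §2′: slope `stepBal N Lc − rr`, defect `2A′`) serves road (2)'s node U2 on the AF side — by composition with
any `betaAvgAFH_of_…` producer; nothing instantiated for Bałaban's objects. [cite: Balaban1987RG1, (2.12)–(2.14) p.268, (0.20) p.256, Thm 2 p.259] -/
theorem injectedRate_of_runs_driftOneSided {β : HBeta} (S : B12Beta.OneLoopSplit β) {b A r γ c θ C : ℝ}
    {Λ : ℕ → ℕ → ℝ} (g : ℕ → ℕ → ℝ) (gIR : ℝ) (hdrift : OneLoopDrift b A S.β0)
    (hlow : ∀ k (p : Fin (k + 1) → ℝ), p ∈ B12Beta.HistBox γ k → -r ≤ S.β1 k p) (hrb : r < b)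
    (hγ : 0 < γ) (hAγ : 2 * A * γ ^ 2 ≤ 1 / 2) (hθ0 : 0 < θ) (hθ1 : θ < 1) (hc : 0 ≤ c) (hC : 0 ≤ C)
    (hrun : ∀ K, RGEqH K β (g K)) (hbox : ∀ K i, i ≤ K → 0 < g K i ∧ g K i ≤ γ)
    (hpin : ∀ K, g K K = gIR)
    (hS : ScaleShiftRate c θ γ β) (hL : HistLipschitz Λ γ β) (hΛ : FadingMemory C θ Λ)
    (hsmall : C * ((Real.sqrt 2 * γ) ^ 3 + 2 * (Real.sqrt 2 * γ) / (b - r)) ≤ (1 - θ) / 2) :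
    T4CauchySum.InjectedRate (2 * c / (1 - θ)) 0 θ (fun K j => disc (g K) (g (K + 1)) j) :=
  injectedRate_of_runs_avgAFH g gIR hγ (sub_pos.mpr hrb) hAγ hθ0 hθ1 hc hC hrun hbox hpin hS hL hΛ
    (betaAvgAFH_of_driftOneSided S hdrift hlow) hsmall

/-! ## 3. Sharpness (a): node U2's AF input is a SLOPE consumer — at slope 0 the weight sum is not K-uniform -/

namespace Margin

open Literature.MathematicalPhysics.QuantumFieldTheory.Balaban1983to89.Beta.ConstRemainderConsumers.Margin
  (betaM cont upper_and_sign)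
open Literature.MathematicalPhysics.QuantumFieldTheory.Balaban1983to89.Beta.AveragedAFCarrier.Margin
  (modelOf_run_const avgAFH_zero endpointExistence_modelOf)

/-- Along the runs of the honest margin construction `modelOf (betaM b γ)` from the bare coupling `γ` (constant `≡ γ`,
`AveragedAFCarrier.Margin.modelOf_run_const`; they are infrared-PINNED at `γ` for every `K`) the U2 weight sum of the pair
(K, K + 1) is `(K + 1)γ³`. [folklore] -/
theorem weightSum_modelOf (b : ℝ) {γ : ℝ} (hγ : 0 < γ) (K m : ℕ) :
    ∑ i ∈ range (K + 1), ((modelOf (betaM b γ) ⟨K, m, γ⟩).flow.g i) ^ 2 *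
        (modelOf (betaM b γ) ⟨K + 1, m, γ⟩).flow.g (i + 1) = ((K : ℝ) + 1) * γ ^ 3 := by
  have hA := modelOf_run_const b hγ K m
  have hB := modelOf_run_const b hγ (K + 1) m
  simp_rw [hA, hB]
  rw [Finset.sum_const, Finset.card_range, nsmul_eq_mul]
  push_cast
  ring

/-- … hence admits NO K-uniform bound. [folklore] -/
theorem weightSum_modelOf_unbounded (b : ℝ) {γ : ℝ} (hγ : 0 < γ) (m : ℕ) (U : ℝ) :
    ∃ K : ℕ, U < ∑ i ∈ range (K + 1), ((modelOf (betaM b γ) ⟨K, m, γ⟩).flow.g i) ^ 2 *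
        (modelOf (betaM b γ) ⟨K + 1, m, γ⟩).flow.g (i + 1) := by
  have hγ3 : 0 < γ ^ 3 := pow_pos hγ 3
  obtain ⟨K, hK⟩ := exists_nat_gt (U / γ ^ 3)
  refine ⟨K, ?_⟩
  rw [weightSum_modelOf b hγ K m]
  rw [div_lt_iff₀ hγ3] at hK
  nlinarith

/-- **(a) recorded — SLOPE 0 DOES NOT SERVE NODE U2's AF INPUT, INHABITED.**  For every `γ > 0`, `b ≥ 0`: a history family `β`
and a construction `C` forward-generated by (0.20) with `β`, halting outside, currying `β`, with the SIGN `0 ≤ β` and the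
printed-type bound `β ≤ b` on the `]0,γ]`-boxes, continuity, the END grade at slope EXACTLY 0 (`BetaAvgAFH 0 0 γ β`, no `s > 0`),
and `EndpointExistence C` — whose runs from the bare coupling `γ` are in `]0,γ]` and infrared-pinned at `γ` for EVERY horizon,
while their U2 weight sums `Σ_{i≤K}(g^{(K)}_i)² g^{(K+1)}_{i+1}` are UNBOUNDED in K.  So pv16's input `U` (hence the smallness
`C·U ≤ (1−θ)/2` of `disc_le_of_fadingMemory`, and the exponent of `disc_le_of_lastOnly`) is NOT available at the Gloss-3 END grade:
node U2's AF input is an `s > 0` consumer, like (2.46) (census C8). [cite: Balaban1987RG1, Thm 2 p.259] -/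
theorem slope_zero_not_enough_T4 {γ b : ℝ} (hγ : 0 < γ) (hb : 0 ≤ b) :
    ∃ (β : HBeta) (C : B12.Construction), ForwardGenerated C β ∧ HaltsOutside C β ∧ CurriesHBeta C β ∧
      BetaContH γ β ∧ BetaUpperH b γ β ∧ BetaLowerH 0 γ β ∧
      BetaAvgAFH 0 0 γ β ∧ (∀ s D : ℝ, 0 < s → ¬ BetaAvgAFH s D γ β) ∧ EndpointExistence C ∧
      (∀ K m : ℕ, (C ⟨K, m, γ⟩).flow.InInterval γ K ∧ (C ⟨K, m, γ⟩).flow.g K = γ) ∧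
      ∀ (m : ℕ) (U : ℝ), ∃ K : ℕ,
        U < ∑ i ∈ range (K + 1), ((C ⟨K, m, γ⟩).flow.g i) ^ 2 * (C ⟨K + 1, m, γ⟩).flow.g (i + 1) := by
  refine ⟨betaM b γ, modelOf (betaM b γ), modelOf_forwardGenerated _, modelOf_haltsOutside _, modelOf_curries _,
    cont b γ γ, (upper_and_sign hb hγ).1, (upper_and_sign hb hγ).2, avgAFH_zero hb hγ,
    fun s D hs => AveragedAFCarrier.Margin.not_avgAFH_pos hγ hs, endpointExistence_modelOf hb hγ, fun K m => ?_,
    fun m U => weightSum_modelOf_unbounded b hγ m U⟩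
  have hconst := modelOf_run_const b hγ K m
  exact ⟨fun k _ => by rw [hconst k]; exact ⟨hγ, le_rfl⟩, hconst K⟩

end Margin

/-! ## 4. Sharpness (b): NE4 is touched by NO β-side grade of road (1) — the oscillating family at «Theorem 2 as printed» grade -/

namespace Osc

open Literature.MathematicalPhysics.QuantumFieldTheory.Balaban1983to89.Beta.AveragedAFCarrier.Osc
  (betaO cont_and_bounds avgAFH)

/-- With `c ≤ s` the oscillating family `β_{k+1} = s + c(−1)^k` is POSITIVELY bounded below on every box: `s − c ≤ β` —
the (AF-0s) / «Theorem 2 as printed» grade (`FlowStep.BetaLowerH (s − c)`). [folklore] -/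
theorem betaLowerH (s c γ : ℝ) (hc : 0 ≤ c) : BetaLowerH (s - c) γ (betaO s c) := by
  intro k v _
  have hpow : -1 ≤ ((-1 : ℝ)) ^ k := by
    have : |((-1 : ℝ)) ^ k| = 1 := by rw [abs_pow, abs_neg, abs_one, one_pow]
    exact (abs_le.mp this.le).1
  show s - c ≤ s + c * (-1) ^ k
  nlinarith

/-- The consecutive-scale difference of the oscillating family AT FIXED COUPLINGS is the constant `∓2c`:
`β_{k+2}(w) − β_{k+1}(tail w) = −2c(−1)^k` (history-free family: the arguments play no role). [folklore] -/
theorem shift_eq (s c : ℝ) (k : ℕ) (w : Fin (k + 2) → ℝ) :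
    betaO s c (k + 1) w - betaO s c k (Fin.tail w) = -(2 * c * (-1) ^ k) := by
  simp only [betaO, pow_succ]
  ring

/-- `c′θ^k` drops below any positive level for some `k` when `θ < 1` (Mathlib's `exists_pow_lt_of_lt_one`; for `c′ ≤ 0` already at
`k = 0`). [folklore] -/
theorem exists_lt_of_geom {c' θ a : ℝ} (hθ1 : θ < 1) (ha : 0 < a) : ∃ k : ℕ, c' * θ ^ k < a := by
  by_cases hc' : c' ≤ 0
  · exact ⟨0, by rw [pow_zero, mul_one]; linarith⟩
  · push Not at hc'
    obtain ⟨k, hk⟩ := exists_pow_lt_of_lt_one (div_pos ha hc') hθ1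
    refine ⟨k, ?_⟩
    rw [lt_div_iff₀ hc'] at hk
    linarith [mul_comm (θ ^ k) c']

/-- **NE4 FAILS for the oscillating family**: `¬ ScaleShiftRate c′ θ γ (betaO s c)` for every `c′`, every `θ < 1`, every
`γ > 0`, as soon as `c > 0` — the scale shift at fixed couplings is `2c` at EVERY scale (`shift_eq`). [folklore] -/
theorem not_scaleShiftRate {s c θ γ : ℝ} (hc : 0 < c) (hθ1 : θ < 1) (hγ : 0 < γ) (c' : ℝ) :
    ¬ ScaleShiftRate c' θ γ (betaO s c) := by
  intro h
  obtain ⟨k, hk⟩ := exists_lt_of_geom (c' := c') hθ1 (by linarith : (0 : ℝ) < 2 * c)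
  have hw : (fun _ : Fin (k + 2) => γ) ∈ Box γ (k + 1) := mem_box.mpr fun _ => ⟨hγ, le_rfl⟩
  have h1 := h k _ hw
  rw [shift_eq] at h1
  have habs : |-(2 * c * (-1 : ℝ) ^ k)| = 2 * c := by
    rw [abs_neg, abs_mul, abs_pow, abs_neg, abs_one, one_pow, mul_one, abs_of_pos (by linarith)]
  rw [habs] at h1
  linarith

/-- **EVERY PINNED PAIR HAS DISCREPANCY EXACTLY `2c` ONE SCALE BELOW THE PIN.**  For any two solutions of the history recursion
(0.20) with the oscillating family — `gA` over `K ≥ 1` steps, `gB` over `K + 1` steps — pinned at the end (`g^A_K = g^B_{K+1}`):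
`disc gA gB (K − 1) = |1/(g^A_{K−1})² − 1/(g^B_K)²| = |β_K − β_{K+1}| = 2c`.  (No box or positivity hypothesis is needed.)
[cite: Balaban1987RG1, (0.20) p.256 and Thm 2 p.259] -/
theorem disc_last {s c : ℝ} (hc : 0 ≤ c) {K : ℕ} (hK : 1 ≤ K) {gA gB : ℕ → ℝ}
    (hA : RGEqH K (betaO s c) gA) (hB : RGEqH (K + 1) (betaO s c) gB) (hpin : gA K = gB (K + 1)) :
    disc gA gB (K - 1) = 2 * c := by
  obtain ⟨k, rfl⟩ : ∃ k, K = k + 1 := ⟨K - 1, by omega⟩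
  rw [Nat.add_sub_cancel]
  have h1 := hA k (by omega)
  have h2 := hB (k + 1) (by omega)
  have e : 1 / (gA k) ^ 2 - 1 / (gB (k + 1)) ^ 2 = 2 * c * (-1) ^ k := by
    rw [h1, h2, hpin]
    simp only [betaO, pow_succ]
    ring
  unfold disc
  rw [e, abs_mul, abs_pow, abs_neg, abs_one, one_pow, mul_one, abs_of_nonneg (by linarith)]

/-- **NO INJECTED GEOMETRIC RATE for any infrared-pinned family of runs of the oscillating family** (`c > 0`, `θ < 1`, any
constant `Cr`): node U2's conclusion `T4CauchySum.InjectedRate Cr 0 θ (fun K j ↦ disc (g K) (g (K+1)) j)` FAILS — at `j = K − 1`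
the discrepancy is `2c` for every `K` (`disc_last`) while `Cr·θ^{K−1} → 0`. [folklore] -/
theorem not_injectedRate {s c θ : ℝ} (hc : 0 < c) (hθ1 : θ < 1) {g : ℕ → ℕ → ℝ}
    (hrun : ∀ K, RGEqH K (betaO s c) (g K)) (hpin : ∀ K, g K K = g (K + 1) (K + 1)) (Cr : ℝ) :
    ¬ T4CauchySum.InjectedRate Cr 0 θ (fun K j => disc (g K) (g (K + 1)) j) := by
  intro h
  obtain ⟨k, hk⟩ := exists_lt_of_geom (c' := Cr) hθ1 (by linarith : (0 : ℝ) < 2 * c)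
  have h1 := (h (k + 1) k (by omega)).2
  have h2 := disc_last hc.le (K := k + 1) (by omega) (hrun (k + 1)) (hrun (k + 1 + 1)) (hpin (k + 1))
  simp only [Nat.add_sub_cancel, pow_zero, mul_one] at h1 h2
  rw [h2] at h1
  linarith

/-- **THE COUPLING ONE SCALE ABOVE THE UNIT SCALE DOES NOT CONVERGE AS THE CUTOFF IS REMOVED.**  For runs `g^{(K)}` of (0.20) with
the oscillating family, all pinned at `g_K = g_IR`: `1/(g^{(K)}_{K−1})² = 1/g_IR² + s + c(−1)^{K−1}` (`K ≥ 1`) — it ALTERNATES with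
the parity of K, consecutive cutoffs differing by exactly `2c` in the variable `1/g²`. [cite: Balaban1987RG1, (0.20) p.256] -/
theorem one_below_pin {s c gIR : ℝ} {g : ℕ → ℕ → ℝ} (hrun : ∀ K, RGEqH K (betaO s c) (g K))
    (hpin : ∀ K, g K K = gIR) {K : ℕ} (hK : 1 ≤ K) :
    1 / (g K (K - 1)) ^ 2 = 1 / gIR ^ 2 + (s + c * (-1) ^ (K - 1)) ∧
      |1 / (g (K + 1) K) ^ 2 - 1 / (g K (K - 1)) ^ 2| = 2 * |c| := by
  obtain ⟨k, rfl⟩ : ∃ k, K = k + 1 := ⟨K - 1, by omega⟩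
  rw [Nat.add_sub_cancel]
  have h1 : 1 / (g (k + 1) k) ^ 2 = 1 / gIR ^ 2 + (s + c * (-1) ^ k) := by
    have := hrun (k + 1) k (by omega)
    rw [hpin (k + 1)] at this
    simpa [betaO] using this
  have h2 : 1 / (g (k + 1 + 1) (k + 1)) ^ 2 = 1 / gIR ^ 2 + (s + c * (-1) ^ (k + 1)) := by
    have := hrun (k + 1 + 1) (k + 1) (by omega)
    rw [hpin (k + 1 + 1)] at this
    simpa [betaO] using this
  refine ⟨h1, ?_⟩
  rw [h1, h2]
  rw [show 1 / gIR ^ 2 + (s + c * (-1 : ℝ) ^ (k + 1)) - (1 / gIR ^ 2 + (s + c * (-1) ^ k)) = -(2 * c * (-1) ^ k) by ring,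
    abs_neg, abs_mul, abs_mul, abs_pow, abs_neg, abs_one, one_pow, mul_one]
  norm_num

/-- **(b) recorded — A «THEOREM 2 AS PRINTED»-GRADE FAMILY WITH AN HONEST CONSTRUCTION, ENDPOINT EXISTENCE, AND NO COUPLING
MATCHING.**  For `0 < c < s` and `γ > 0`: the history-free family `β = betaO s c` and its canonical construction
`C = FlowStepRuns.modelOf β` satisfy — forward generation by (0.20), halting outside, currying; joint continuity; the SIGN-type
bounds `0 < s − c ≤ β ≤ s + c` on the `]0,γ]`-boxes (hence every β-side hypothesis road (1) consumes at ANY of its glosses, and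
«Theorem 2 as printed» material, RULING (R6)); `EndpointExistence C`; and yet: `β` violates NE4 (`ScaleShiftRate c′ θ γ β` for no
`c′`, no `θ < 1`), and for every `m` there are an interval bound `γ₂ > 0`, for every `γ′ ≤ γ₂` a threshold `g⋆ > 0`, and for every
`g_IR ∈ ]0,g⋆]` bare couplings `g0 K` whose runs `C ⟨K, m, g0 K⟩` stay in `]0,γ′]` and are pinned at `g_IR` for EVERY `K` — along
which the coupling discrepancy one scale below the pin is EXACTLY `2c` for every `K ≥ 1` and NO injected geometric rate
`InjectedRate Cr 0 θ` exists.  So node U2's conclusion — and with it the K → ∞ convergence of the coupling at fixed physical scale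
— is NOT implied by any β-side grade of road (1); NE4-type scale-convergence of the β-family is an input of road (2) beyond road (1).
[cite: Balaban1987RG1, (0.20) p.256, Thm 2 p.259, §1 p.264] -/
theorem thm2grade_no_matching {s c γ : ℝ} (hc : 0 < c) (hcs : c < s) (hγ : 0 < γ) :
    ∃ (β : HBeta) (C : B12.Construction), ForwardGenerated C β ∧ HaltsOutside C β ∧ CurriesHBeta C β ∧
      BetaContH γ β ∧ BetaLowerH (s - c) γ β ∧ BetaUpperH (s + c) γ β ∧ 0 < s - c ∧
      EndpointExistence C ∧
      (∀ (c' θ : ℝ), θ < 1 → ¬ ScaleShiftRate c' θ γ β) ∧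
      ∀ m : ℕ, ∃ γ₂ : ℝ, 0 < γ₂ ∧ ∀ γ' : ℝ, 0 < γ' → γ' ≤ γ₂ → ∃ gstar : ℝ, 0 < gstar ∧
        ∀ gIR : ℝ, 0 < gIR → gIR ≤ gstar → ∃ g0 : ℕ → ℝ,
          (∀ K : ℕ, (C ⟨K, m, g0 K⟩).flow.InInterval γ' K ∧ (C ⟨K, m, g0 K⟩).flow.g K = gIR) ∧
          (∀ K : ℕ, 1 ≤ K →
            disc (C ⟨K, m, g0 K⟩).flow.g (C ⟨K + 1, m, g0 (K + 1)⟩).flow.g (K - 1) = 2 * c) ∧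
          ∀ (Cr θ : ℝ), θ < 1 →
            ¬ T4CauchySum.InjectedRate Cr 0 θ
              (fun K j => disc (C ⟨K, m, g0 K⟩).flow.g (C ⟨K + 1, m, g0 (K + 1)⟩).flow.g j) := by
  have hs : 0 ≤ s := by linarith
  obtain ⟨hcont, hup, -⟩ := cont_and_bounds hs hc.le γ
  have hlow := betaLowerH s c γ hc.le
  have hsign : FlowStep.BetaLowerH 0 γ (betaO s c) := fun k v hv => by
    have := hlow k v hv; linarith
  have hex : EndpointExistence (modelOf (betaO s c)) :=
    endpointExistence_modelOf (betaO s c) hγ (by linarith) hcont hsign hup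
  refine ⟨betaO s c, modelOf (betaO s c), modelOf_forwardGenerated _, modelOf_haltsOutside _, modelOf_curries _, hcont,
    hlow, hup, by linarith, hex, fun c' θ hθ1 => not_scaleShiftRate hc hθ1 hγ c', fun m => ?_⟩
  obtain ⟨γ₂, hγ₂, hrun⟩ := hex m
  refine ⟨γ₂, hγ₂, fun γ' hγ' hγ'le => ?_⟩
  obtain ⟨gstar, hgstar, hK⟩ := hrun γ' hγ' hγ'le
  refine ⟨gstar, hgstar, fun gIR hgIR hgIRle => ?_⟩
  choose g0 hg0 using hK gIR hgIR hgIRle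
  have hrg : ∀ K, RGEqH K (betaO s c) (modelOf (betaO s c) ⟨K, m, g0 K⟩).flow.g := fun K =>
    rgEqH_of_inInterval (modelOf_forwardGenerated _) (modelOf_haltsOutside _) (modelOf_curries _) ⟨K, m, g0 K⟩ (hg0 K).1
  have hpin : ∀ K, (modelOf (betaO s c) ⟨K, m, g0 K⟩).flow.g K = (modelOf (betaO s c) ⟨K + 1, m, g0 (K + 1)⟩).flow.g (K + 1) :=
    fun K => (hg0 K).2.trans (hg0 (K + 1)).2.symm
  refine ⟨g0, hg0, fun K hK => disc_last hc.le hK (hrg K) (hrg (K + 1)) (hpin K), fun Cr θ hθ1 => ?_⟩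
  exact not_injectedRate (g := fun K => (modelOf (betaO s c) ⟨K, m, g0 K⟩).flow.g) hc hθ1 hrg hpin Cr

end Osc

/-! ## 5. (v1.1) The (0.31)-LITERAL consumers of road (2): what the carrier gives (a DEFECTED running), and what Gloss 3″'s
literal carrier does NOT give on infinitely many lattices

The T⁴ cell consumes the LITERAL two-sided running (0.31) of [Balaban1987RG1] Thm 2 p. 259 — `Step.Discrete031 b β′ K g gs`:
`1/g² + b(K−k) ≤ 1/g_k² ≤ 1/g² + β′(K−k)` for all `k ≤ K` — as the β-side hypothesis `h031` of many nodes (`T4SyncThresholds`,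
`T4MatchingAssembly`, `T4Crossover`, `T4HistoryPeeling`, `T4GoodClassBudget`, `T4WeightBudget`, `T4TubeBudget`, `T4PeierlsDomination`,
`T4GatedBooking`, `T4BookingNecessity`, `T4UniformRadius`; T4-DAG H3 «the running bound (0.31)»).  That is «THEOREM 2 AS PRINTED»
material (RULING (R6)).  Status by grade, kernel: Gloss 2 (`EventualForm`) gives it with `b/2` on all FINE lattices
`K ≥ k₀(3 + 2β′/b)` (`FlowStepRuns.thm2_fineLattices_of_eventualLower` — harmless for road (2), which lets K → ∞); the slope-carrying
END grade gives it only in DEFECTED form (`discrete031Defect_of_avgAFH` below: the lower anchor `1/g²` replaced by `1/g² − D`); and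
Gloss 3″'s LITERAL carrier does NOT give the literal lower half on ANY even lattice (`Osc.not_discrete031_even`: for the oscillating
family with `s < c` the coupling one scale above the pin EXCEEDS the pinned value), while it does on every odd one
(`Osc.discrete031_odd`) — a parity phenomenon with no fine-lattice rescue; inhabited for the honest construction
(`Osc.modelOf_not_discrete031`).  Census row C18.  Whether each T⁴ use of `h031` survives the defect (it replaces the infrared
anchor `1/g²` by `1/g² − D ≥ 1/(2g²)`) is for the node owners; nothing of theirs is touched here. -/

/-- **THE DEFECTED RUNNING FROM THE CARRIER** (what the β sub-cell's END grade with slope delivers toward the T⁴ cell's `h031`):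
along a solution of (0.20) with couplings in `]0,γ]` up to `K`, `BetaAvgAFH s D γ β` and the printed-type upper bound `β ≤ β′` on the
boxes give, for every `k ≤ K`, `1/g_K² + s(K−k) − D ≤ 1/g_k² ≤ 1/g_K² + β′(K−k)` — `Step.Discrete031 s β′ K g_K` up to the additive
defect `D` in the lower half.  (Upper half: [Balaban1987RG1] p. 264 «uniformly bounded»; lower half: the carrier.) [cite: Balaban1987RG1, (0.31) p.259 and §1 p.264] -/
theorem discrete031Defect_of_avgAFH {β : HBeta} {γ s D β' : ℝ} {K : ℕ} {gs : ℕ → ℝ} (h : RGEqH K β gs)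
    (hbox : ∀ i, i ≤ K → 0 < gs i ∧ gs i ≤ γ) (hav : BetaAvgAFH s D γ β) (hup : BetaUpperH β' γ β) :
    ∀ k, k ≤ K → 1 / (gs K) ^ 2 + s * ((K : ℝ) - k) - D ≤ 1 / (gs k) ^ 2 ∧
      1 / (gs k) ^ 2 ≤ 1 / (gs K) ^ 2 + β' * ((K : ℝ) - k) := by
  intro k hk
  refine ⟨?_, ?_⟩
  · have := inv_sq_lower_of_avgAFH h hbox hav hk
    rw [Nat.cast_sub hk] at this
    exact this
  · rw [inv_sq_telescopeH h hk le_rfl]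
    have hsum := Finset.sum_le_card_nsmul (Ico k K) (fun j => β j (prefixOf gs j)) β'
      (fun j hj => hup j _ (prefixOf_mem_box (Finset.mem_Ico.mp hj).2.le hbox))
    rw [Nat.card_Ico, nsmul_eq_mul, Nat.cast_sub hk] at hsum
    linarith

/-- … hence the LITERAL lower half with slope `s/2` at every scale at least `2D/s` above the infrared end (`s > 0`):
`(s/2)(K−k) ≥ D ⟹ 1/g_K² + (s/2)(K−k) ≤ 1/g_k²`.  The last `⌈2D/s⌉` scales before the pin are exactly where the defect bites.
[cite: Balaban1987RG1, (0.31) p.259] -/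
theorem discrete031_lower_farIR_of_avgAFH {β : HBeta} {γ s D : ℝ} {K : ℕ} {gs : ℕ → ℝ} (h : RGEqH K β gs)
    (hbox : ∀ i, i ≤ K → 0 < gs i ∧ gs i ≤ γ) (hav : BetaAvgAFH s D γ β) {k : ℕ} (hk : k ≤ K)
    (hfar : D ≤ s / 2 * ((K : ℝ) - k)) : 1 / (gs K) ^ 2 + s / 2 * ((K : ℝ) - k) ≤ 1 / (gs k) ^ 2 := by
  have := inv_sq_lower_of_avgAFH h hbox hav hk
  rw [Nat.cast_sub hk] at this
  linarith

namespace Osc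

open Literature.MathematicalPhysics.QuantumFieldTheory.Balaban1983to89.Beta.AveragedAFCarrier.Osc
  (betaO cont_and_bounds avgAFH endpointExistence_modelOf)

/-- Closed form of the alternating window sum: `Σ_{j∈[k,K)} (−1)^j = ((−1)^k − (−1)^K)/2`. [folklore] -/
theorem sum_negOnePow_Ico (k K : ℕ) (hkK : k ≤ K) :
    ∑ j ∈ Ico k K, ((-1 : ℝ)) ^ j = ((-1 : ℝ) ^ k - (-1) ^ K) / 2 := by
  induction K, hkK using Nat.le_induction with
  | base => simp
  | succ m hkm ih =>
    rw [Finset.sum_Ico_succ_top hkm, ih, pow_succ]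
    ring

/-- Telescoped (0.20) for the oscillating family: `1/g_k² = 1/g_K² + s(K−k) + c((−1)^k − (−1)^K)/2`, `k ≤ K`. [cite: Balaban1987RG1, (0.20) p.256] -/
theorem inv_sq_eq {s c : ℝ} {K : ℕ} {gs : ℕ → ℝ} (h : RGEqH K (betaO s c) gs) {k : ℕ} (hk : k ≤ K) :
    1 / (gs k) ^ 2 = 1 / (gs K) ^ 2 + s * ((K : ℝ) - k) + c * (((-1 : ℝ) ^ k - (-1) ^ K) / 2) := by
  rw [inv_sq_telescopeH h hk le_rfl]
  have hsum : ∑ j ∈ Ico k K, betaO s c j (prefixOf gs j) = s * ((K : ℝ) - k) + c * ∑ j ∈ Ico k K, ((-1 : ℝ)) ^ j := by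
    simp only [betaO]
    rw [Finset.sum_add_distrib, Finset.sum_const, Nat.card_Ico, nsmul_eq_mul, Nat.cast_sub hk, ← Finset.mul_sum]
    ring
  rw [hsum, sum_negOnePow_Ico k K hk]
  ring

/-- **(0.31) LITERAL FAILS ON EVERY EVEN LATTICE for Gloss 3″'s oscillating carrier.**  For `s < c` (negative β at odd scales),
`b ≥ 0`, any `β′`, any `g`, and ANY solution `gs` of (0.20) with the family `betaO s c` over `K = 2n+2` steps:
`¬ Step.Discrete031 b β′ (2n+2) g gs` — at `k = K` the running pins `1/g_K² = 1/g²`, and one scale above, `1/g_{K−1}² = 1/g² + s − c < 1/g²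
≤ 1/g² + b`.  (The carrier `BetaAvgAFH s c` holds nonetheless — `AveragedAFCarrier.Osc.avgAFH`.) [cite: Balaban1987RG1, (0.31) p.259] -/
theorem not_discrete031_even {s c b β' g : ℝ} (hsc : s < c) (hb : 0 ≤ b) (n : ℕ) {gs : ℕ → ℝ}
    (h : RGEqH (2 * n + 2) (betaO s c) gs) : ¬ Step.Discrete031 b β' (2 * n + 2) g gs := by
  intro h031
  have hK := h031 (2 * n + 2) le_rfl
  have hK1 := (h031 (2 * n + 1) (by omega)).1
  have hstep := h (2 * n + 1) (by omega)
  have hm1 : ((-1 : ℝ)) ^ (2 * n + 1) = -1 := by rw [pow_succ, pow_mul]; norm_num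
  have hodd : betaO s c (2 * n + 1) (prefixOf gs (2 * n + 1)) = s - c := by
    simp only [betaO, hm1]
    ring
  rw [hodd] at hstep
  have e1 : ((2 * n + 2 : ℕ) : ℝ) - ((2 * n + 2 : ℕ) : ℝ) = 0 := by ring
  have e2 : ((2 * n + 2 : ℕ) : ℝ) - ((2 * n + 1 : ℕ) : ℝ) = 1 := by push_cast; ring
  rw [e1] at hK
  rw [e2] at hK1
  have hpin : 1 / (gs (2 * n + 2)) ^ 2 = 1 / g ^ 2 := by linarith [hK.1, hK.2]
  rw [show 2 * n + 1 + 1 = 2 * n + 2 by ring, hpin] at hstep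
  linarith

/-- **… AND HOLDS ON EVERY ODD LATTICE** (so the failure is a PARITY phenomenon, with no fine-lattice rescue — unlike Gloss 2's
`FlowStepRuns.thm2_fineLattices_of_eventualLower`): for `0 ≤ c` (any `s`) and a solution `gs` over `K = 2n+1` steps pinned at
`1/g_K² = 1/g²`, `Step.Discrete031 s (s + c) (2n+1) g gs` — the alternating suffix sums `c·((−1)^k + 1)/2` are `≥ 0` and `≤ c`.
[cite: Balaban1987RG1, (0.31) p.259] -/
theorem discrete031_odd {s c g : ℝ} (hc : 0 ≤ c) (n : ℕ) {gs : ℕ → ℝ}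
    (h : RGEqH (2 * n + 1) (betaO s c) gs) (hpin : 1 / (gs (2 * n + 1)) ^ 2 = 1 / g ^ 2) :
    Step.Discrete031 s (s + c) (2 * n + 1) g gs := by
  intro k hk
  have heq := inv_sq_eq h hk
  rw [hpin] at heq
  have hKodd : ((-1 : ℝ)) ^ (2 * n + 1) = -1 := by rw [pow_succ, pow_mul]; norm_num
  rw [hKodd] at heq
  have hpk : -1 ≤ ((-1 : ℝ)) ^ k ∧ ((-1 : ℝ)) ^ k ≤ 1 := by
    have : |((-1 : ℝ)) ^ k| = 1 := by rw [abs_pow, abs_neg, abs_one, one_pow]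
    exact abs_le.mp this.le
  have hKk : (0 : ℝ) ≤ ((2 * n + 1 : ℕ) : ℝ) - k := by
    have : (k : ℝ) ≤ ((2 * n + 1 : ℕ) : ℝ) := by exact_mod_cast hk
    linarith
  refine ⟨?_, ?_⟩
  · -- lower: c·((−1)^k + 1)/2 ≥ 0
    have hC : 0 ≤ c * (1 + ((-1 : ℝ)) ^ k) := mul_nonneg hc (by linarith [hpk.1])
    linarith [hC, heq]
  · -- upper: s(K−k) + c((−1)^k+1)/2 ≤ (s+c)(K−k) when K − k ≥ 1; at k = K both vanish
    rcases Nat.eq_or_lt_of_le hk with hkK | hkK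
    · subst hkK
      rw [hKodd] at heq
      have : ((2 * n + 1 : ℕ) : ℝ) - ((2 * n + 1 : ℕ) : ℝ) = 0 := by ring
      rw [this] at heq ⊢
      linarith
    · have h1 : (1 : ℝ) ≤ ((2 * n + 1 : ℕ) : ℝ) - k := by
        have : (k : ℝ) + 1 ≤ ((2 * n + 1 : ℕ) : ℝ) := by exact_mod_cast hkK
        linarith
      have hA : 0 ≤ c * (((2 * n + 1 : ℕ) : ℝ) - k - 1) := mul_nonneg hc (by linarith)
      have hB : 0 ≤ c * (1 - ((-1 : ℝ)) ^ k) := mul_nonneg hc (by linarith [hpk.2])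
      nlinarith [hA, hB, heq]

/-- **(c) recorded — INHABITED: an honest construction served the whole [III] list along its runs, whose pinned runs VIOLATE the
literal (0.31) on every even lattice.**  For `s > 0` and the oscillating carrier `betaO s (2s)` (Gloss 3″'s literal carrier of
`AveragedAFCarrier` §5(b)/§6(a)), `C = FlowStepRuns.modelOf (betaO s (2s))` has `EndpointExistence`; for every `m` there are an interval
bound `γ₂ > 0`, for every `γ′ ≤ γ₂` a threshold `g⋆ > 0`, and for every `g ∈ ]0,g⋆]` bare couplings `g0 K` whose runs `C ⟨K, m, g0 K⟩` stay
in `]0,γ′]` with `g_K = g` for EVERY `K` — and for every EVEN `K = 2n+2` that run violates `Step.Discrete031 b β′ K g` for every `b ≥ 0`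
and every `β′`.  So the T⁴ cell's `h031` inputs are NOT delivered LITERALLY by the wall's grade on infinitely many lattices; they are
delivered in DEFECTED form (`discrete031Defect_of_avgAFH`) — census row C18. [cite: Balaban1987RG1, Thm 2 (0.31) p.259] -/
theorem modelOf_not_discrete031 {s : ℝ} (hs : 0 < s) :
    EndpointExistence (modelOf (betaO s (2 * s))) ∧
      ∀ m : ℕ, ∃ γ₂ : ℝ, 0 < γ₂ ∧ ∀ γ' : ℝ, 0 < γ' → γ' ≤ γ₂ → ∃ gstar : ℝ, 0 < gstar ∧
        ∀ g : ℝ, 0 < g → g ≤ gstar → ∃ g0 : ℕ → ℝ,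
          (∀ K : ℕ, (modelOf (betaO s (2 * s)) ⟨K, m, g0 K⟩).flow.InInterval γ' K ∧
            (modelOf (betaO s (2 * s)) ⟨K, m, g0 K⟩).flow.g K = g) ∧
          ∀ (n : ℕ) (b β' : ℝ), 0 ≤ b →
            ¬ Step.Discrete031 b β' (2 * n + 2) g (modelOf (betaO s (2 * s)) ⟨2 * n + 2, m, g0 (2 * n + 2)⟩).flow.g := by
  have hsc : s < 2 * s := by linarith
  have hex : EndpointExistence (modelOf (betaO s (2 * s))) := endpointExistence_modelOf hs
  refine ⟨hex, fun m => ?_⟩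
  obtain ⟨γ₂, hγ₂, hrun⟩ := hex m
  refine ⟨γ₂, hγ₂, fun γ' hγ' hγ'le => ?_⟩
  obtain ⟨gstar, hgstar, hK⟩ := hrun γ' hγ' hγ'le
  refine ⟨gstar, hgstar, fun g hg hgle => ?_⟩
  choose g0 hg0 using hK g hg hgle
  refine ⟨g0, hg0, fun n b β' hb => ?_⟩
  have hrg : RGEqH (2 * n + 2) (betaO s (2 * s)) (modelOf (betaO s (2 * s)) ⟨2 * n + 2, m, g0 (2 * n + 2)⟩).flow.g :=
    rgEqH_of_inInterval (modelOf_forwardGenerated _) (modelOf_haltsOutside _) (modelOf_curries _) ⟨2 * n + 2, m, g0 (2 * n + 2)⟩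
      (hg0 (2 * n + 2)).1
  exact not_discrete031_even hsc hb n hrg

end Osc

/-! ## 6. (v1.2) The NE4 witness against the spine's GENERAL shape: no injected rate with ANY polynomial exponent

`T4CauchySum.InjectedRate C c θ` allows a polynomial factor `(K+1)^c` («through which alone asymptotic freedom enters», node U6's
logarithmic-running form).  The oscillating family defeats it for EVERY exponent `c`: its discrepancy `2c_osc` sits at `j = K − 1`, where
`(K+1)^c θ^{K−1} → 0`.  So census row C17 does not depend on the exponent-0 form of node U2's output. -/

namespace Osc

open Literature.MathematicalPhysics.QuantumFieldTheory.Balaban1983to89.Beta.AveragedAFCarrier.Osc (betaO)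

/-- **NO INJECTED RATE WITH ANY POLYNOMIAL EXPONENT** for an infrared-pinned family of (0.20)-runs of the oscillating family (`c > 0`,
`0 < θ < 1`, any constant `Cr`, any exponent `p`): `¬ InjectedRate Cr p θ (fun K j ↦ disc (g K) (g (K+1)) j)` — by `disc_last` the
discrepancy at `j = K − 1` is `2c` for every `K`, while `Cr (K+1)^p θ^{K−1} → 0` (Mathlib's `tendsto_pow_const_mul_const_pow_of_abs_lt_one`).
[folklore] -/
theorem not_injectedRate_poly {s c θ : ℝ} (hc : 0 < c) (hθ0 : 0 < θ) (hθ1 : θ < 1) {g : ℕ → ℕ → ℝ}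
    (hrun : ∀ K, RGEqH K (betaO s c) (g K)) (hpin : ∀ K, g K K = g (K + 1) (K + 1)) (Cr : ℝ) (p : ℕ) :
    ¬ T4CauchySum.InjectedRate Cr p θ (fun K j => disc (g K) (g (K + 1)) j) := by
  intro h
  have ht : Filter.Tendsto (fun n : ℕ => (n : ℝ) ^ p * θ ^ n) Filter.atTop (nhds 0) :=
    tendsto_pow_const_mul_const_pow_of_abs_lt_one p (by rw [abs_of_pos hθ0]; exact hθ1)
  have hCr : 0 < |Cr| + 1 := by positivity
  have hε : (0 : ℝ) < 2 * c * θ ^ 2 / (|Cr| + 1) := by positivity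
  obtain ⟨N, hN⟩ := Filter.eventually_atTop.mp (ht.eventually (gt_mem_nhds hε))
  have hNn := hN (N + 2) (by omega)
  have h1 := (h (N + 1) N (by omega)).2
  have h2 := disc_last hc.le (K := N + 1) (by omega) (hrun (N + 1)) (hrun (N + 1 + 1)) (hpin (N + 1))
  simp only [Nat.add_sub_cancel] at h2
  dsimp only at h1
  rw [h2] at h1
  have hcast : ((N + 1 : ℕ) : ℝ) + 1 = ((N + 2 : ℕ) : ℝ) := by push_cast; ring
  rw [hcast] at h1
  -- h1 : 2c ≤ Cr · (N+2)^p · θ^N ;  hNn : (N+2)^p · θ^(N+2) < 2cθ²/(|Cr|+1)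
  set X : ℝ := ((N + 2 : ℕ) : ℝ) ^ p * θ ^ N with hX
  have hX0 : 0 ≤ X := by positivity
  have hθ2 : 0 < θ ^ 2 := by positivity
  have hXε : X * θ ^ 2 < 2 * c * θ ^ 2 / (|Cr| + 1) := by
    have e : ((N + 2 : ℕ) : ℝ) ^ p * θ ^ (N + 2) = X * θ ^ 2 := by rw [hX, pow_add]; ring
    rw [← e]; exact hNn
  have hX1 : X * (|Cr| + 1) < 2 * c := by
    rw [lt_div_iff₀ hCr] at hXε
    nlinarith
  have hle : Cr * X ≤ |Cr| * X := mul_le_mul_of_nonneg_right (le_abs_self Cr) hX0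
  have hab : 0 ≤ |Cr| := abs_nonneg Cr
  have e1 : Cr * ((N + 2 : ℕ) : ℝ) ^ p * θ ^ N = Cr * X := by rw [hX]; ring
  rw [e1] at h1
  nlinarith [mul_nonneg hab hX0]

end Osc

end

end Literature.MathematicalPhysics.QuantumFieldTheory.Balaban1983to89.Beta.CouplingMatchingCarrier
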